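import Summits.ResolutionOfSingularities.ResolutionOfSingularities.Theorems.KaplanskyLadderDefectless
import Summits.ResolutionOfSingularities.ResolutionOfSingularities.Theorems.KaplanskyDefectless
import HarnessLib

/-!
# DefectlessLadder — decomp-res node «DefectlessLadder» (lens-1 g19, Σ₁ hygiene of «PerronLadder»), tree
file 1/1 of the Kaplansky part

Content VERBATIM from the decomp-res lens-1 g19 rev 1 TREE-FACING COMPANION
`HOME/decomp-res-lens-1/g19/tree/DefectlessLadderTree.lean`
(sha256 45a9879c65cfd008…, 1724 l, rc 0 · 0 sorry · axioms standard per the lens's `tree/*.json`; it is the tree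
projection of the node
`g19/DefectlessLadder.lean` bf11eb22…, CRITIC-LEDGER row 145, decomp-res-crit-1 g5 2026-08-30T21:39:44Z «URGENT
HYGIENE (cn26)», landing plan
(K)(L)(M)(N) of the lens's WRITER.md rev 1, endorsed).  HOME = run/shared/lean/pub/decomp-res.  WHY: the landed g18 port
`PerronCharts.MonoidalStep` is REFUTABLE AS TYPED (parameter families with a repeated non-unit member;
`not_isParamFamily_of_mul_mem`),
so the landed `PerronLadder.toricAscentRk1_three` / `closes_perron*` carry a vacuous binder `(hStep : MonoidalStep)`
— sound, not citable.
These files add the corrected statement `MonoidalStepD` (distinct non-unit members), PROVE it in kernel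
(`monoidalStepD_holds`, tree file
`PerronSigmaStep`), and re-thread PART V to the Σ₁-FREE closure `closes_sigma` (tree file `PerronSigmaAscent`)
— pure additions under FRESH
names in the companion's namespace `…Theorems.DefectlessLadder`; no landed statement is edited.  Landed by
decomp-res writer g7 as SUPPORT
(helper) of the Valuative route item 0641 `LuAlphaPTorsor`; no Valuative route edit is made by the decomp-res cell
(MonoidalStep must simply never be
filed or served as an item; the closure now runs modulo floor CP2019 + CJS2020 + Π₁ `KK05NCVAscent` + the
residual family `NonKHToricArchLU 3 3 d`
+ `PatchingRel`).

PART VI §25-D + §26 of the node: transport to an arbitrary rank-one valued field (`valuation_le_pow_of_rankOne`, …) and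
**`tratOfDefectlessBase_holds : KaplanskyLadder.TratOfDefectlessBase`** — the g17/g18 bridge of the
Kaplansky–Hensel cut (landed as a `def` in
`Theorems/KaplanskyLadderDefectless`) PROVED in kernel from the Literature files `KaplanskyDefectlessType` /
`KaplanskyDefectless` (Kaplansky over a
rank-one defectless base without pseudo-convergent sequences); the discharged cell theorems
`khTopBelow_of_defectlessTop'`, `defectlessHenselLU_of_kh'`,
`defectlessHenselLU_three'` (DefectlessHenselLU 3 n at every rung modulo the Cossart–Piltant floor ALONE) and
`tratOfDefectlessBase_iff_true`.
PROVED, 0 sorry.  (This file is the «Kaplansky part» 1/1; the Σ₁ part is `PerronSigma` / `PerronSigmaStep` /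
`PerronSigmaAscent`.)

(Sources: de Jong 1996 (2.4) / Stacks 0BIQ (blow-up charts); CossartPiltant2019; CossartJannsenSaito2020;
KnafKuhlmann2005 arXiv:math/0304159 §4 Thm 4.1; Zariski1940 §B; Cutkosky arXiv:1404.7459 §2.1; Kaplansky1942
Lemma 5, Thm 3; Kuhlmann2010 arXiv:1003.5678 Lemma 2.4, Thm 2.14; KnafKuhlmann2009 Lemma 2.16.)
-/

noncomputable section

open IsLocalRing Literature.AlgebraicGeometry.Resolution
open Summit.ResolutionOfSingularities.ResolutionOfSingularities.Theses
open Summit.ResolutionOfSingularities.ResolutionOfSingularities.Theorems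
open Summit.ResolutionOfSingularities.ResolutionOfSingularities.Theorems.PfaffLine
open Summit.ResolutionOfSingularities.ResolutionOfSingularities.Theorems.ToricLadder
open Summit.ResolutionOfSingularities.ResolutionOfSingularities.Theorems.KaplanskyLadder
open Polynomial

namespace Summit.ResolutionOfSingularities.ResolutionOfSingularities.Theorems.DefectlessLadder

/-! ### Transport to an arbitrary valued field `(K, O)` of rank one -/

section Transport

/-- **Mathlib's `RankOne` is archimedean on values**: if `O.valuation` has rank one and
`1 < v a`, every value `v b` is below some power `v a ^ n`. [folklore] -/
theorem valuation_le_pow_of_rankOne {K : Type*} [Field K] (O : ValuationSubring K)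
    (hRO : O.valuation.RankOne) {a : K} (b : K) (ha : 1 < O.valuation a) :
    ∃ n : ℕ, O.valuation b ≤ O.valuation a ^ n := by
  haveI := hRO
  have harch : MulArchimedean
      (MonoidWithZeroHom.ValueGroup₀ (MonoidWithZeroHom.ofClass O.valuation)) :=
    Valuation.nonempty_rankOne_iff_mulArchimedean.mp ⟨hRO⟩
  set f := MonoidWithZeroHom.ofClass O.valuation with hf
  have hfa : ∀ x, f x = O.valuation x := fun x => rfl
  have hmono := MonoidWithZeroHom.ValueGroup₀.embedding_strictMono (f := f)
  have h1 : (1 : MonoidWithZeroHom.ValueGroup₀ f) < MonoidWithZeroHom.ValueGroup₀.restrict₀ f a := by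
    rw [← hmono.lt_iff_lt, map_one, MonoidWithZeroHom.ValueGroup₀.embedding_restrict₀, hfa]
    exact ha
  obtain ⟨n, hn⟩ := MulArchimedean.arch (MonoidWithZeroHom.ValueGroup₀.restrict₀ f b) h1
  have h2 := hmono.monotone hn
  rw [map_pow, MonoidWithZeroHom.ValueGroup₀.embedding_restrict₀,
    MonoidWithZeroHom.ValueGroup₀.embedding_restrict₀, hfa, hfa] at h2
  exact ⟨n, h2⟩

/-- **THE BRIDGE, PROVED.** Kaplansky's condition (3) ("(trat)") for a transcendental `z` at
bounded distance from a DEFECTLESS subfield `F` of a rank-one valued field `(K, O)` with `F(z)|F`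
immediate: transport into an algebraic closure `Ω ⊇ K` with an extension `V` of `O`
(`exists_valuationSubring_comap_eq`), where `kaplansky_condition_of_isDefectlessField` applies. [folklore] -/
theorem tratOfDefectlessBase_holds : TratOfDefectlessBase := by
  intro K _ O hRO F hdef z hzt hval hres hbd g hg
  classical
  obtain ⟨hRO⟩ := hRO
  -- the ambient algebraic closure and an extension `V` of `O` to it
  obtain ⟨V, hV⟩ := exists_valuationSubring_comap_eq (Ω := AlgebraicClosure K) O
  set ι : K →+* AlgebraicClosure K := algebraMap K (AlgebraicClosure K) with hι
  have hequiv : (V.valuation.comap ι).IsEquiv O.valuation := isEquiv_valuation_comap ι hV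
  have hle : ∀ r s : K, V.valuation (ι r) ≤ V.valuation (ι s) ↔ O.valuation r ≤ O.valuation s :=
    fun r s => hequiv r s
  have heq : ∀ r s : K, V.valuation (ι r) = V.valuation (ι s) ↔ O.valuation r = O.valuation s :=
    fun r s => valuation_map_eq_iff ι hV r s
  have h1lt : ∀ r : K, 1 < V.valuation (ι r) ↔ 1 < O.valuation r :=
    fun r => hequiv.one_lt_iff_one_lt
  -- `z ∉ F`, `ι z ∉ ι(F)`
  have hzF : z ∉ F := not_mem_of_forall_eval_eq_zero F hzt
  have hzF' : ι z ∉ F.map ι := by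
    intro h
    obtain ⟨c, hcF, hcz⟩ := Subfield.mem_map.mp h
    exact hzF (ι.injective hcz ▸ hcF)
  -- elements of `ι(F)(ι z)` come from `F(z)`
  have hmem : ∀ w', w' ∈ Subfield.closure ((F.map ι : Set (AlgebraicClosure K)) ∪ {ι z}) →
      ∃ w ∈ Subfield.closure ((F : Set K) ∪ {z}), ι w = w' := by
    intro w' hw'
    rw [← Set.image_singleton, ← map_closure_union] at hw'
    exact Subfield.mem_map.mp hw'
  have hval' : ∀ w' ∈ Subfield.closure ((F.map ι : Set (AlgebraicClosure K)) ∪ {ι z}), w' ≠ 0 →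
      ∃ b' ∈ F.map ι, V.valuation w' = V.valuation b' := by
    intro w' hw' hw'0
    obtain ⟨w, hw, rfl⟩ := hmem w' hw'
    have hw0 : w ≠ 0 := fun h => hw'0 (by rw [h, map_zero])
    obtain ⟨b, hbF, hb⟩ := hval w hw hw0
    exact ⟨ι b, Subfield.mem_map.mpr ⟨b, hbF, rfl⟩, (heq w b).mpr hb⟩
  have hres' : ∀ w' ∈ Subfield.closure ((F.map ι : Set (AlgebraicClosure K)) ∪ {ι z}), w' ∈ V →
      ∃ c' ∈ F.map ι, V.valuation (w' - c') < 1 := by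
    intro w' hw' hw'V
    obtain ⟨w, hw, rfl⟩ := hmem w' hw'
    have hwO : w ∈ O := by
      rw [← hV, ValuationSubring.mem_comap]
      exact hw'V
    obtain ⟨c, hcF, hc⟩ := hres w hw hwO
    refine ⟨ι c, Subfield.mem_map.mpr ⟨c, hcF, rfl⟩, ?_⟩
    rw [← map_sub, valuation_map_lt_one_iff ι hV]
    exact hc
  -- non-triviality on `F` and a bound `b ∈ F`
  obtain ⟨a₀, ha₀F, ha₀⟩ := exists_one_lt_valuation_of_immediate (V := O) (F := F) hzF hval hres
  have hbd' : ∃ b' ∈ F.map ι, b' ≠ 0 ∧ ∀ a' ∈ F.map ι,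
      V.valuation b' ≤ V.valuation (ι z - a') := by
    obtain ⟨b, hb0, hb⟩ := hbd
    obtain ⟨n, hn⟩ := valuation_le_pow_of_rankOne O hRO b⁻¹ ha₀
    have ha₀0 : a₀ ≠ 0 := fun h => by
      rw [h, map_zero] at ha₀
      exact not_lt_of_ge zero_le_one ha₀
    have hbn : O.valuation (a₀ ^ n)⁻¹ ≤ O.valuation b := by
      rw [map_inv₀, map_pow]
      rw [map_inv₀] at hn
      exact inv_le_of_inv_le₀ ((Valuation.pos_iff _).mpr hb0) hn
    refine ⟨ι (a₀ ^ n)⁻¹, Subfield.mem_map.mpr ⟨_, F.inv_mem (F.pow_mem ha₀F n), rfl⟩,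
      (_root_.map_ne_zero ι).mpr (inv_ne_zero (pow_ne_zero n ha₀0)), fun a' ha' => ?_⟩
    obtain ⟨a, haF, rfl⟩ := Subfield.mem_map.mp ha'
    rw [← map_sub, hle]
    exact hbn.trans (hb a haF)
  -- rank one and defectless for `ι(F)`
  have hr1 : IsRankOneValued V (F.map ι) := by
    refine ⟨⟨ι a₀, Subfield.mem_map.mpr ⟨a₀, ha₀F, rfl⟩, (h1lt a₀).mpr ha₀⟩,
      fun a' ha' b' hb' h1 => ?_⟩
    obtain ⟨a, haF, rfl⟩ := Subfield.mem_map.mp ha'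
    obtain ⟨b, hbF, rfl⟩ := Subfield.mem_map.mp hb'
    obtain ⟨n, hn⟩ := valuation_le_pow_of_rankOne O hRO b ((h1lt a).mp h1)
    refine ⟨n, ?_⟩
    rw [← map_pow, ← map_pow, hle, map_pow]
    exact hn
  obtain ⟨φ, hφ⟩ := exists_ringEquiv_map ι F
  have hdef' : IsDefectlessField (F.map ι) (V.comap (algebraMap (F.map ι) (AlgebraicClosure K))) := by
    refine IsDefectlessField.congr φ ?_ hdef
    ext x
    rw [ValuationSubring.mem_comap, ValuationSubring.mem_comap, ValuationSubring.mem_comap,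
      ← hV, ValuationSubring.mem_comap]
    change ι x ∈ V ↔ ((φ x : F.map ι) : AlgebraicClosure K) ∈ V
    rw [hφ x]
  -- the ambient theorem for `g.map ι`
  have hg' : ∀ i, (g.map ι).coeff i ∈ F.map ι := fun i => by
    rw [coeff_map]
    exact Subfield.mem_map.mpr ⟨_, hg i, rfl⟩
  obtain ⟨a₁', ha₁', α', hα'⟩ :=
    kaplansky_condition_of_isDefectlessField hr1 hdef' hzF' hval' hres' hbd' hg'
  obtain ⟨a₁, ha₁F, rfl⟩ := Subfield.mem_map.mp ha₁'
  refine ⟨a₁, ha₁F, O.valuation (g.eval a₁), fun a haF hle' => ?_⟩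
  have h₁ := hα' (ι a₁) (Subfield.mem_map.mpr ⟨a₁, ha₁F, rfl⟩) le_rfl
  have h₂ := hα' (ι a) (Subfield.mem_map.mpr ⟨a, haF, rfl⟩)
    (by rw [← map_sub, ← map_sub, hle]; exact hle')
  rw [eval_map, eval₂_hom] at h₁ h₂
  exact (heq _ _).mp (h₂.trans h₁.symm)

end Transport

/-! ## 26. Consequences: the defectless cells of §16 are decided modulo the floor ONLY (KERNEL) -/

section Consequences

variable {k K : Type} [Field k] [Field K] [Algebra k K]

/-- **K16′ · a defectless bounded top IS a Kaplansky–Hensel top** — §16's `khTopBelow_of_defectlessTop` with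
its bridge hypothesis `hT : TratOfDefectlessBase` DISCHARGED by `tratOfDefectlessBase_holds` (kernel). [folklore] -/
theorem khTopBelow_of_defectlessTop' (O : ValuationSubring K) (h1 : Nonempty O.valuation.RankOne) {c : ℕ}
    (hD : DefectlessTopBelow k O c) : KHTopBelow k O c :=
  khTopBelow_of_defectlessTop tratOfDefectlessBase_holds O h1 hD

end Consequences

end Summit.ResolutionOfSingularities.ResolutionOfSingularities.Theorems.DefectlessLadder
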